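/-
Copyright (c) 2026. All rights reserved.
Released under Apache 2.0 license as described in the file LICENSE.
-/
import Summits.CriticalPhenomena.LaceExpansionHighD.NobleBoundsNSharpSlots
import HarnessLib

/-!
# Fitzner–van der Hofstad (2017), Prop. 5.5 (5.34) at `N = M + 2` against the SHARP blocks, hypothesis-free — Part V
§Bordered–§RealRows: from `(5.34)♯` to the bordered `3 × 3` numeric matrices (`secStarB'_chain_le_bordered`,
`tsum_nobleXiT_le_borderedBSharp`), the payload split of the Sharp middle matrix for the numerics side
(`matB_blockBSharp_le`), and the real `N ≥ 2` rows from entrywise majorants (`nobleXiN_perN_of_sharpMajorants`, the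
`hN` of `NobleNSums.NSumLE_rows_of_bounds`) (WHAT-IF, DIVERGENCE D77; b2b-lace LEMMAS node N76-X2-D77, module 10/11)

[FvdH17] = R. Fitzner, R. van der Hofstad, *Mean-field behavior for nearest-neighbor percolation in `d > 10`*,
arXiv:1506.07977v2 (EJP 22 (2017), paper 43).  Page numbers refer to the arXiv version.

The two purely algebraic steps that make `tsum_nobleXiT_le_secStarBSharp` consumable by the numerics side,
mirroring the print chain's `tsum_nobleXiT_le_bordered'_of_cover` (size model as a kernel inequality) and
`nobleXiN_perN_of_chain` (real majorants): the extended middle matrix of the `(β′)` section-choice pair is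
dominated entrywise by the `3 × 3` matrix `matB (blockBFullB' L X₂)` bordered with its row `2` and column `0`,
and entrywise real majorants of the five numeric objects `vecPS`, `vecPE`, `matB (blockBFullB' L (blockX₂Sharp L))`,
`matAbar (blockAbar' L)` then give, for every `N ≥ 2`, summability of `Ξ^{(N)}` and the real row
`Σ_x Ξ^{(N)}(x) ≤ uℝ · (Bℝ^{N−1} Aℝ) · wℝ` — literally the `hN` consumed by `NobleNSums.NSumLE_rows_of_bounds`.
The middle section splits the Sharp middle matrix for the numerics side (`matB_blockBSharp_le`).
Nothing in the first section is specific to the payload.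

SPLIT PROVENANCE: module 10 of 11 of the b2b-lace node N76-X2-D77 (what-if, DIVERGENCE D77) — the 11 modules are the
section-seam split (carver-g217, 2026-08-27) of the single-module form `NobleBoundsNSharpD77.lean` (carver-g51
text-final, sha256 `877e12977f9f9c92`, 2707 lines): every declaration, statement and proof is carried over verbatim and
in the original order; only module boundaries, the repeated `section`/`variable` headers and two docstrings were added.
PLACEMENT: what-if objects of `NobleBlocksSharp` (b2b-lace LEAN PLACEMENT RULE, REFEREE R491), hence
`namespace Summit.CriticalPhenomena.LaceExpansionHighD.NobleBlocks`.  Conventions: `d`-generic; every declaration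
carries its [FvdH17] display / page cite in the docstring; NOTHING is cited as a fact (b2b-lace ABSOLUTE RULE);
additive (no existing declaration is changed). -/

noncomputable section

namespace Summit.CriticalPhenomena.LaceExpansionHighD.NobleBlocks

open Literature.Probability.FitznerVanDerHofstad2017 Literature.Probability.FitznerVanDerHofstad2017.NobleBlocks
open Literature.Probability.FitznerVanDerHofstad2017.NobleBlocks.LenIdx
open Literature.Probability.LatticeModels Literature.Probability.Percolation
open Literature.Probability.FitznerVanDerHofstad2017.BlockSummation
open Literature.Barriers.CriticalPhenomena
open Literature.Combinatorics.SimpleGraph _root_.SimpleGraph _root_.MeasureTheory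
open scoped BigOperators ENNReal Matrix

variable {d : ℕ}

section Bordered

variable (L : Letters d)

/-- **Size model as a kernel inequality for a `(β′)` pair with payload** (`B := blockBFullB' L X₂`,
`Bpt := blockBFullpt' L X`, `Σ_{t,z} X = X₂`): the section-choice chain value is dominated by the chain value of
the `3 × 3` matrices bordered with row `2` / column `0`,
`(P⃗^S,0) · [[B, B_{·,0}],[B_{2,·}, B_{2,0}]]^n · [[Ā′,0],[Ā′_{2,·},0]] · (P⃗^E,0)`.
[cite: FitznerVanDerHofstad2017, Prop. 5.5 (5.34) (arXiv:1506.07977v2 p. 53); §5.1 "Elements of the bounds" (p. 49); Lemma 6.1 and §6.2.1 (pp. 65–67)] -/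
theorem secStarB'_chain_le_bordered (X : DirBlockFamilyPt d) (X₂ : DirBlockFamily d)
    (hX : ∀ κ a a' u w w' u', ∑' t, ∑' z, X κ a a' u w t z w' u' = X₂ κ a a' u w w' u') (n : ℕ) :
    vecP (starS (blockPS L)) ᵥ*
        matB (starB (blockBFullB' L X₂) (secEc (blockBFullpt' L X) 0) (secEo (blockBFullpt' L X) 2)
          (secEoc (blockBFullpt' L X) 2 0)) ^ n ᵥ*
          matAbar (starA (blockAbar' L) (secEA (blockAbar' L) 2)) ⬝ᵥ vecP (starS (blockPE L)) ≤
      Sum.elim (vecPS L) (0 : Unit → ℝ≥0∞) ᵥ*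
        Matrix.fromBlocks (matB (blockBFullB' L X₂)) (Matrix.of fun (a : Fin 3) (_ : Unit) => matB (blockBFullB' L X₂) a 0)
          (Matrix.of fun (_ : Unit) (a' : Fin 3) => matB (blockBFullB' L X₂) 2 a')
          (Matrix.of fun (_ : Unit) (_ : Unit) => matB (blockBFullB' L X₂) 2 0) ^ n ᵥ*
        Matrix.fromBlocks (matAbar (blockAbar' L)) (0 : Matrix (Fin 3) Unit ℝ≥0∞)
          (Matrix.of fun (_ : Unit) (c : Fin 3) => matAbar (blockAbar' L) 2 c) (0 : Matrix Unit Unit ℝ≥0∞) ⬝ᵥ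
          Sum.elim (vecPE L) (0 : Unit → ℝ≥0∞) := by
  rw [vecP_starS, vecP_starS]
  have hB : ∀ i j,
      matB (starB (blockBFullB' L X₂) (secEc (blockBFullpt' L X) 0) (secEo (blockBFullpt' L X) 2)
          (secEoc (blockBFullpt' L X) 2 0)) i j ≤
        Matrix.fromBlocks (matB (blockBFullB' L X₂)) (Matrix.of fun (a : Fin 3) (_ : Unit) => matB (blockBFullB' L X₂) a 0)
          (Matrix.of fun (_ : Unit) (a' : Fin 3) => matB (blockBFullB' L X₂) 2 a')
          (Matrix.of fun (_ : Unit) (_ : Unit) => matB (blockBFullB' L X₂) 2 0) i j := by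
    intro i j
    have h := matB_starB_sec_le (blockBFullptB'_hBpt L X X₂ hX) 2 0 i j
    rw [secEc_blockBFullptB', secEo_blockBFullptB', secEoc_blockBFullptB'] at h
    exact h
  exact star_chain_mono (fun i => le_rfl) hB (matAbar_starA_sec_le (blockAbar' L) 2) (fun i => le_rfl) n

end Bordered

section PayloadMatrix

variable (L : Letters d)

/-- The `(β′)` middle block is additive in its payload: `B′(X₂) = B′(0) + X₂` pointwise.
[cite: FitznerVanDerHofstad2017, §5.1 (5.4) (arXiv:1506.07977v2 p. 48); App. B (p. 76)] -/
theorem blockBFullB'_eq_add_payload (X₂ : DirBlockFamily d) :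
    blockBFullB' L X₂ = fun κ a b => fun u v x y => blockBFullB' L 0 κ a b u v x y + X₂ κ a b u v x y := by
  funext κ a b u v x y
  simp only [blockBFullB', blockB', Pi.zero_apply, add_zero]

/-- In column `2` the `R`-slice is a vertex composition of the row-`(a,1)` letter with the off-diagonal sausage
`q(z) = 𝟙{z ≠ 0} P^{0}(z,z)`. [cite: FitznerVanDerHofstad2017, §5.1 (5.4) second term (arXiv:1506.07977v2 p. 48); App. B Table "A^{ι,a,b}" (p. 75)] -/
theorem blockT2Sharp_two_eq_compVertex (κ : Fin d × Bool) (a : Fin 3) (u v x t y : Site d) :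
    blockT2Sharp L κ a 2 u v x t y = blockAiota' L κ a 1 u v x t * (kdc (y - t) 0 * blockPS L 0 (y - t) (y - t)) := by
  rw [blockT2Sharp_two]
  have hk : kdc t y = kdc (y - t) 0 := by simp [kdc, sub_eq_zero, eq_comm]
  rw [hk, mul_left_comm]

/-- **Matrix-level bound of the summed `R`-slice**: `‖Σ_t T2♯‖_{a,b} ≤ 𝟙{b = 2} (A^{ι})_{a,1} · Σ_{z ≠ 0} P^{0}(z,z)`
(the notebook's `Matrix[Aiota,s]*Bound[PS,0,s]` shape, row `(a,1)` read in column `2`).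
[cite: FitznerVanDerHofstad2017, §5.1 (5.4) second term and "Elements of the bounds" (arXiv:1506.07977v2 pp. 48–49)] -/
theorem matB_tsum_blockT2Sharp_le (a b : Fin 3) :
    matB (fun κ a b => fun u v x y => ∑' t, blockT2Sharp L κ a b u v x t y) a b ≤
      if b = 2 then matB (blockAiota' L) a 1 * ∑' z, kdc z 0 * blockPS L 0 z z else 0 := by
  by_cases hb : b = 2
  · subst hb
    rw [if_pos rfl]
    calc matB (fun κ a b => fun u v x y => ∑' t, blockT2Sharp L κ a b u v x t y) a 2
        = matB (fun κ a (_ : Fin 3) => fun u v x y =>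
            ∑' t, blockAiota' L κ a 1 u v x t * (kdc (y - t) 0 * blockPS L 0 (y - t) (y - t))) a 2 := by
          simp only [matB_apply, blockT2Sharp_two_eq_compVertex]
      _ ≤ matB (fun κ a (_ : Fin 3) => blockAiota' L κ a 1) a 2 * ∑' z, kdc z 0 * blockPS L 0 z z :=
          matB_compVertex_le (fun κ a (_ : Fin 3) => blockAiota' L κ a 1) (fun z => kdc z 0 * blockPS L 0 z z) a 2
      _ = matB (blockAiota' L) a 1 * ∑' z, kdc z 0 * blockPS L 0 z z := by simp only [matB_apply]
  · rw [if_neg hb, matB_apply]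
    refine iSup_le fun v => ?_
    simp [blockT2Sharp_of_ne, hb]

/-- **The Sharp middle matrix split for the numerics side**:
`(B♯′)_{a,b} ≤ (B′)_{a,b} + Σ_c (A'^{ι,*})_{a,c} (A♯)_{c,b} + 𝟙{b = 2} (A^{ι})_{a,1} Σ_{z ≠ 0} P^{0}(z,z)`, where
`(B′) = matB (blockBFullB' L 0)` is the printed `(β′)` middle matrix, `(A'^{ι,*}) = matB (blockAiotaSt' L)` and
`(A^{ι}) = matB (blockAiota' L)` are printed matrices, and `(A♯)_{c,b} = matB₀ (blockASharp L) c b =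
sup_v Σ_{y ≠ 0} (δ_{v,0} | 2dD(v) | 1)_c · τ_{j_b}(y) τ_{≥1}(v − y)` (column `b = 0` zero) is the ONLY new numeric
object — the `x = 0` slice of Table `A^{a,b}` that the print excludes.
[cite: FitznerVanDerHofstad2017, §5.1 (5.4)–(5.6) and "Elements of the bounds" (arXiv:1506.07977v2 pp. 48–49); App. B Table "definition of A^{a,b}(0,v,x,y)" (p. 74); §4.4 (4.64) (p. 42)] -/
theorem matB_blockBSharp_le (a b : Fin 3) :
    matB (blockBFullB' L (blockX₂Sharp L)) a b ≤
      matB (blockBFullB' L 0) a b + (matB (blockAiotaSt' L) * matB₀ (blockASharp L)) a b +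
        (if b = 2 then matB (blockAiota' L) a 1 * ∑' z, kdc z 0 * blockPS L 0 z z else 0) := by
  have hX : blockX₂Sharp L = fun κ a b => fun u v x y =>
      (fun κ a b => fun u v x y => ∑ c : Fin 3, comp (blockAiotaSt' L κ a c) (blockASharp L c b) u v x y) κ a b u v x y +
        (fun κ a b => fun u v x y => ∑' t, blockT2Sharp L κ a b u v x t y) κ a b u v x y := by
    funext κ a b u v x y
    rfl
  rw [blockBFullB'_eq_add_payload L (blockX₂Sharp L)]
  refine (matB_add_le _ _ a b).trans ?_
  rw [Matrix.add_apply, add_assoc]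
  gcongr
  rw [hX]
  refine (matB_add_le _ _ a b).trans ?_
  rw [Matrix.add_apply]
  exact add_le_add (matB_comp_le (blockAiotaSt' L) (isTransInv_blockASharp L) a b) (matB_tsum_blockT2Sharp_le L a b)

end PayloadMatrix


section RealRows

variable (p : unitInterval)

/-- **`(5.34)♯` in bordered form**: for every `M`,
`Σ_x Ξ̃^{(M+2)}(x) ≤ (P⃗^S,0) · [[B♯′, B♯′_{·,0}],[B♯′_{2,·}, B♯′_{2,0}]]^{M+1} · [[Ā′,0],[Ā′_{2,·},0]] · (P⃗^E,0)` with
`B♯′ = matB (blockBFullB' L (blockX₂Sharp L))`, `L = Letters.perc d p`.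
[cite: FitznerVanDerHofstad2017, Prop. 5.5 (5.34) (arXiv:1506.07977v2 p. 53); §5.1 "Elements of the bounds" (p. 49); §4.4 (4.64) (p. 42)] -/
theorem tsum_nobleXiT_le_borderedBSharp (M : ℕ) :
    ∑' x, nobleXiT d p (M + 2) x ≤
      Sum.elim (vecPS (Letters.perc d p)) (0 : Unit → ℝ≥0∞) ᵥ*
        Matrix.fromBlocks (matB (blockBFullB' (Letters.perc d p) (blockX₂Sharp (Letters.perc d p))))
          (Matrix.of fun (a : Fin 3) (_ : Unit) => matB (blockBFullB' (Letters.perc d p) (blockX₂Sharp (Letters.perc d p))) a 0)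
          (Matrix.of fun (_ : Unit) (a' : Fin 3) => matB (blockBFullB' (Letters.perc d p) (blockX₂Sharp (Letters.perc d p))) 2 a')
          (Matrix.of fun (_ : Unit) (_ : Unit) => matB (blockBFullB' (Letters.perc d p) (blockX₂Sharp (Letters.perc d p))) 2 0) ^ (M + 1) ᵥ*
        Matrix.fromBlocks (matAbar (blockAbar' (Letters.perc d p))) (0 : Matrix (Fin 3) Unit ℝ≥0∞)
          (Matrix.of fun (_ : Unit) (c : Fin 3) => matAbar (blockAbar' (Letters.perc d p)) 2 c) (0 : Matrix Unit Unit ℝ≥0∞) ⬝ᵥ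
          Sum.elim (vecPE (Letters.perc d p)) (0 : Unit → ℝ≥0∞) :=
  (tsum_nobleXiT_le_secStarBSharp p M).trans
    (secStarB'_chain_le_bordered (Letters.perc d p) (blockXSharp (Letters.perc d p)) (blockX₂Sharp (Letters.perc d p))
      (tsum_tsum_blockXSharp (Letters.perc d p)) (M + 1))

/-- **The real `N ≥ 2` rows from `(5.34)♯` and numeric majorants** — literally the `hN` of
`NobleNSums.NSumLE_rows_of_bounds`: given non-negative real majorants `uℝ, wℝ` of `P⃗^S, P⃗^E`, `Bℝ` of
`matB (blockBFullB' L (blockX₂Sharp L))` (the printed `(B′)` matrix plus the two D77 residue rows) and `Aℝ` of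
`matAbar (blockAbar' L)`, every `Ξ^{(N)}`, `N ≥ 2`, is summable with
`Σ_x Ξ^{(N)}(x) ≤ (uℝ,0) · ([[Bℝ, Bℝ_{·,0}],[Bℝ_{2,·}, Bℝ_{2,0}]]^{N−1} · [[Aℝ,0],[Aℝ_{2,·},0]]) · (wℝ,0)`.
[cite: FitznerVanDerHofstad2017, Prop. 5.5 (5.34) (arXiv:1506.07977v2 p. 53); Remark 2.3 (pp. 12–13); §5.4 (p. 56); §4.4 (4.64) (p. 42)] -/
theorem nobleXiN_perN_of_sharpMajorants {uR wR : Fin 3 → ℝ} {BR AR : Matrix (Fin 3) (Fin 3) ℝ}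
    (hu0 : ∀ a, 0 ≤ uR a) (hw0 : ∀ b, 0 ≤ wR b) (hB0 : ∀ a b, 0 ≤ BR a b) (hA0 : ∀ a b, 0 ≤ AR a b)
    (hu : ∀ a, vecPS (Letters.perc d p) a ≤ ENNReal.ofReal (uR a))
    (hw : ∀ b, vecPE (Letters.perc d p) b ≤ ENNReal.ofReal (wR b))
    (hB : ∀ a b, matB (blockBFullB' (Letters.perc d p) (blockX₂Sharp (Letters.perc d p))) a b ≤ ENNReal.ofReal (BR a b))
    (hA : ∀ a b, matAbar (blockAbar' (Letters.perc d p)) a b ≤ ENNReal.ofReal (AR a b)) :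
    ∀ N, 2 ≤ N → Summable (nobleXiN d p N) ∧
      ∑' x, nobleXiN d p N x ≤
        Sum.elim uR (0 : Unit → ℝ) ⬝ᵥ
          ((Matrix.fromBlocks BR (Matrix.of fun (a : Fin 3) (_ : Unit) => BR a 0)
              (Matrix.of fun (_ : Unit) (a' : Fin 3) => BR 2 a') (Matrix.of fun (_ : Unit) (_ : Unit) => BR 2 0) ^ (N - 1) *
            Matrix.fromBlocks AR (0 : Matrix (Fin 3) Unit ℝ) (Matrix.of fun (_ : Unit) (c : Fin 3) => AR 2 c)
              (0 : Matrix Unit Unit ℝ)) *ᵥ Sum.elim wR (0 : Unit → ℝ)) :=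
  nobleXiN_perN_of_chain p (sumElim_nonneg hu0 fun _ => le_rfl) (sumElim_nonneg hw0 fun _ => le_rfl)
    (fromBlocks_nonneg hB0 (fun a _ => hB0 a 0) (fun _ a' => hB0 2 a') fun _ _ => hB0 2 0)
    (fromBlocks_nonneg hA0 (fun _ _ => le_rfl) (fun _ c => hA0 2 c) fun _ _ => le_rfl)
    (sumElim_le_ofReal_sumElim hu zero_le_ofReal_zero_vec) (sumElim_le_ofReal_sumElim hw zero_le_ofReal_zero_vec)
    (fromBlocks_le_ofReal_fromBlocks hB (fun a _ => hB a 0) (fun _ a' => hB 2 a') fun _ _ => hB 2 0)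
    (fromBlocks_le_ofReal_fromBlocks hA zero_le_ofReal_zero (fun _ c => hA 2 c) zero_le_ofReal_zero)
    fun n hn => by
      obtain ⟨M, rfl⟩ := Nat.exists_eq_add_of_le' hn
      exact tsum_nobleXiT_le_borderedBSharp p M

end RealRows

end Summit.CriticalPhenomena.LaceExpansionHighD.NobleBlocks

end
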